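import Summits.QuantumFields.YangMills.Theorems.SwapVirialDeficitSigmaBallUFirst
import HarnessLib

/-!
# END-CORE LEADER-SIDE INTEGRALS, brick (U3): the `z`-letter space integral with the gnomonic weight —
# `∫⁻_{ℝ³} (1+|z|²)^{-2} e^{−c|z|²/(1+|z|²)} ≤ 2·C₃/((1+c)√(1+c))`, `C₃ = ∫_{ℝ³}(1+|w|²)^{-2}`
# (stub `stub_core_end` of skeleton ➎, leader side; the `z`-letter carries the floor `|z|²/(1+|z|²) ≤ 1800L⁶F̂` (✓`gnoDeficit_floor_z`) in the end core;
# free-hands support of ⟨stmt-QuantumFields-24197⟩ `SwapVirialDeficit.SwapGluedStiffness`; LEAD sfw-p2 g99 memo10 §2, answer 2026-08-31 21:56Z (a))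

Same device as brick U1 (✓`weight_mul_exp_le`: `(1+t)^{-2}e^{−ct/(1+t)} ≤ 2/(1+(1+c)t)²`), then the Haar scaling `z ↦ √(1+c)·z` on `EuclideanSpace ℝ (Fin 3)`
(`Measure.integral_comp_smul`, exponent `finrank = 3`) reduces to the absolute constant `C₃ := ∫_{ℝ³} ((1+‖w‖²)²)⁻¹` (finite: ✓`integrable_rpow_neg_one_add_norm_sq`, `r = 4 > 3`;
its value `π²` is not needed and not claimed):
* `integrable_zWeight` — `w ↦ ((1+‖w‖²)²)⁻¹` is integrable on `ℝ³`; `zWeight_smul` — `((1+‖√k·z‖²)²)⁻¹ = ((1+k‖z‖²)²)⁻¹`;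
* ★★ `lintegral_zLetter_le (hc : 0 < c) : ∫⁻ z, ofReal(((1+‖z‖²)²)⁻¹·e^{−(c‖z‖²/(1+‖z‖²))}) ≤ ofReal(2·(∫ w, ((1+‖w‖²)²)⁻¹)/((1+c)·√(1+c)))` — order `c^{-3/2}`, the
  Gaussian normalisation of three letters, as the core/main-term comparison requires.

HONEST LABEL: elementary real analysis (Mathlib + ✓SigmaBallUFirst); `stub_core_end` (split ⧗p835735 LEAD, follower side w2 g60 ✓T1, assembly open), stubs core-tip ∕ 001-good,
⟨24197⟩ ∕ ⟨24194⟩ and every rung OPEN (stub_B_stiff CLOSED by name 22:09Z, g48 ✓p835693); own crux ⟨22884⟩ OPEN (blocked-on ⟨19935⟩); the Yang–Mills mass gap is NOT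
proved; no summit is proved by a line.  THEOREMS ONLY (0 `def`, 0 `sorry`), standard axioms.  Width seat ym-line-sfw-p2-w3 g67 (cell ym-idea-1, free hands),
`--supports stmt-QuantumFields-24197`.  References: [folklore].
-/

set_option autoImplicit false

noncomputable section

open MeasureTheory Set Real Module
open scoped ENNReal

namespace Summit.QuantumFields.YangMills.Theorems.SwapVirialDeficit.SigmaBall

/-- The `z`-weight `((1+‖w‖²)²)⁻¹` is integrable on `ℝ³` (Japanese bracket, `r = 4 > 3`). [folklore] -/
theorem integrable_zWeight : Integrable fun w : EuclideanSpace ℝ (Fin 3) => ((1 + ‖w‖ ^ 2) ^ 2)⁻¹ := by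
  have h := integrable_rpow_neg_one_add_norm_sq (E := EuclideanSpace ℝ (Fin 3)) (μ := volume) (r := 4)
    (by rw [finrank_euclideanSpace, Fintype.card_fin]; norm_num)
  refine h.congr (Filter.Eventually.of_forall fun w => ?_)
  have hw : 0 ≤ 1 + ‖w‖ ^ 2 := by positivity
  show (1 + ‖w‖ ^ 2) ^ (-4 / 2 : ℝ) = ((1 + ‖w‖ ^ 2) ^ 2)⁻¹
  rw [show (-4 / 2 : ℝ) = -(2 : ℝ) by norm_num, Real.rpow_neg hw, Real.rpow_two]

/-- Scaling of the `z`-weight: `((1+‖√k·z‖²)²)⁻¹ = ((1+k‖z‖²)²)⁻¹` (`k ≥ 0`). [folklore] -/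
theorem zWeight_smul {k : ℝ} (hk : 0 ≤ k) (z : EuclideanSpace ℝ (Fin 3)) :
    ((1 + ‖Real.sqrt k • z‖ ^ 2) ^ 2)⁻¹ = ((1 + k * ‖z‖ ^ 2) ^ 2)⁻¹ := by
  rw [norm_smul, Real.norm_eq_abs, abs_of_nonneg (Real.sqrt_nonneg k), mul_pow, Real.sq_sqrt hk]

/-- `∫_{ℝ³} ((1+k‖z‖²)²)⁻¹ = C₃/(k√k)` for `k > 0`, `C₃ = ∫_{ℝ³}((1+‖w‖²)²)⁻¹` (Haar scaling, `finrank = 3`). [folklore] -/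
theorem integral_zWeight_smul {k : ℝ} (hk : 0 < k) :
    ∫ z : EuclideanSpace ℝ (Fin 3), ((1 + k * ‖z‖ ^ 2) ^ 2)⁻¹ =
      (∫ w : EuclideanSpace ℝ (Fin 3), ((1 + ‖w‖ ^ 2) ^ 2)⁻¹) / (k * Real.sqrt k) := by
  have h := Measure.integral_comp_smul_of_nonneg (μ := (volume : Measure (EuclideanSpace ℝ (Fin 3))))
    (fun w : EuclideanSpace ℝ (Fin 3) => ((1 + ‖w‖ ^ 2) ^ 2)⁻¹) (Real.sqrt k) (hR := Real.sqrt_nonneg k)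
  simp only [zWeight_smul hk.le] at h
  rw [h, finrank_euclideanSpace, Fintype.card_fin, smul_eq_mul]
  have hs : Real.sqrt k ^ 3 = k * Real.sqrt k := by
    rw [pow_succ, Real.sq_sqrt hk.le]
  rw [hs, div_eq_inv_mul]

/-- ★★ **THE `z`-LETTER INTEGRAL WITH THE GNOMONIC WEIGHT**: for `c > 0`,
`∫⁻_{ℝ³} ((1+‖z‖²)²)⁻¹·e^{−c‖z‖²/(1+‖z‖²)} ≤ 2·C₃/((1+c)√(1+c))`, `C₃ = ∫_{ℝ³}((1+‖w‖²)²)⁻¹` — order `c^{-3/2}`. [folklore] -/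
theorem lintegral_zLetter_le {c : ℝ} (hc : 0 < c) :
    ∫⁻ z : EuclideanSpace ℝ (Fin 3), ENNReal.ofReal (((1 + ‖z‖ ^ 2) ^ 2)⁻¹ * Real.exp (-(c * ‖z‖ ^ 2 / (1 + ‖z‖ ^ 2)))) ≤
      ENNReal.ofReal (2 * (∫ w : EuclideanSpace ℝ (Fin 3), ((1 + ‖w‖ ^ 2) ^ 2)⁻¹) / ((1 + c) * Real.sqrt (1 + c))) := by
  set k : ℝ := 1 + c with hk
  have hkpos : 0 < k := by rw [hk]; linarith
  -- pointwise
  have hpt : ∀ z : EuclideanSpace ℝ (Fin 3), ENNReal.ofReal (((1 + ‖z‖ ^ 2) ^ 2)⁻¹ * Real.exp (-(c * ‖z‖ ^ 2 / (1 + ‖z‖ ^ 2)))) ≤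
      ENNReal.ofReal (2 * ((1 + k * ‖z‖ ^ 2) ^ 2)⁻¹) := by
    intro z
    refine ENNReal.ofReal_le_ofReal ?_
    have h := weight_mul_exp_le one_pos hc.le (sq_nonneg ‖z‖)
    rw [← hk, div_eq_mul_inv] at h
    exact h
  refine (lintegral_mono hpt).trans ?_
  have hint : Integrable fun z : EuclideanSpace ℝ (Fin 3) => 2 * ((1 + k * ‖z‖ ^ 2) ^ 2)⁻¹ := by
    have h := (integrable_zWeight.comp_smul (Real.sqrt_pos.2 hkpos).ne').const_mul 2
    refine h.congr (Filter.Eventually.of_forall fun z => ?_)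
    simp only [zWeight_smul hkpos.le]
  rw [← ofReal_integral_eq_lintegral_ofReal hint (Filter.Eventually.of_forall fun z => by positivity), integral_const_mul,
    integral_zWeight_smul hkpos]
  refine le_of_eq ?_
  congr 1
  rw [hk]; ring

end Summit.QuantumFields.YangMills.Theorems.SwapVirialDeficit.SigmaBall

end
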